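import Mathlib
import Summits.KontsevichZagierPeriods.KontsevichZagierPeriods.Theorems.InverseLandauTateFamilyKernelRationalCertificate

/-!
# `TateFamilyKernel` — the first symmetry-free weight-2 test family is certified (line `Sketch`, stub `stub_gapInstance`)

Crux `TateFamilyKernel` (stmt-KontsevichZagierPeriods-9130, route `InverseLandau`), line `Sketch`
(card rational-cube-certificates). The card's experiment left ONE explicit candidate obstruction in
dimension `n = 2`: the "gap element"
`F = g/Q`, `Q = 1 − ϖz₁ − ϖz₂² − ϖ²z₁z₂` (Tate, admissible on `(0, √2 − 1)`, no cube symmetry),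
`g = −2z₂³ + ϖz₁z₂² − 2ϖz₂² + 2z₁z₂ + ϖz₁`, whose open-square integrals vanish identically and which
resisted every `m = 0` rational `relA` ansatz and the first `m = 1` ansätze (kit j017109). This file
proves, unconditionally, the conclusion of the crux for this family on its WHOLE admissible range:
at every real-algebraic `ϖ₀` with `0 < ϖ₀`, `ϖ₀² + 2ϖ₀ < 1`, every tame cube representation of the
fibre on `[0,1]²` is a KZ relation (`stub_gapInstance`; the open-square representations of the crux
follow by the landed bridge `of_mem_relations_of_isTameCube`, p104329). The certificate (lead c1) is
a SIX-term sum of Ayoub elements `relA_i(A_k/D_k)` with RATIONAL data in ONE auxiliary cube variable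
`w`, fed to the landed `rational_certificate` (p111536):

* terms 0, 1 (`∂_{z₁}`, `∂_{z₂}`): the de Rham reduction `F = ∂₁G₁ + ∂₂G₂` — writing `Q = a − b z₁`,
  `g = α + βz₁`, the residue form of `F dz₁dz₂` on the rational polar curve has zero residue, so
  `h = −∫(αb+βa)/b² dz₂` is rational, `h = −z₂(z₂+ϖ)(1−ϖz₂²)/(ϖ²(1+ϖz₂))`, and
  `G₁ = −βz₁/b − h∂₂Q/Q`, `G₂ = −hb/Q` (`s1a`); their cube faces are `dlog`s of the EDGE Landau
  polynomials `Q(1,·)`, `Q(·,1)` with the common coefficient `γ = −(1−ϖ)/ϖ²` (`s1b`, `s1c`);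
* terms 2, 3: the swap `γ(ℓ(z₁) − ℓ(z₂))`, `ℓ = dlog Q(·,1)` (LINEAR Landau polynomial), is `m = 0`
  relA-exact with the Tate-homotopy kernel `1/Q(z₁z₂, 1)` (`s2`) — no rule-(2) move is needed;
* terms 4, 5: the closed edge loop `γ·dlog ψ`, `ψ = Q(·,1)/Q(1,·)`, `ψ(0) = ψ(1) = 1`, is relA-exact
  in the auxiliary variable with the homotopy `Ψ = (1 − w) + wψ` (the algebra of the route's
  DlogLoopRelator; `s3a`, `s3b`).

All six denominators are Tate and POSITIVE on the closed cube `[0,1]³` for every admissible `ϖ₀`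
(no wall), so the certificate specialises on the whole admissible range. This answers the card's
"cheapest falsifier" in the affirmative and is the first instance of the line's descent normal form
(`Cruxes/TateFamilyKernel/Lines/Sketch.lean`, `stub_descentNF`) beyond the symmetric families.
References: Kontsevich–Zagier 2001 §1.1–1.2; Ayoub, EMS Newsl. 91 (2014) Def. 10; card
rational-cube-certificates (crux stmt-KontsevichZagierPeriods-9130).
-/

noncomputable section

open MeasureTheory Set MvPolynomial
open Literature.NumberTheory.Transcendental
open Literature.ModelTheory.ExponentialFields (IsSemialgebraic)

namespace Summit.KontsevichZagierPeriods.InverseLandau.TateFamilyKernel.Descent.Gap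

/-! ### The six real identities behind the certificate (`a = z₁`, `b = z₂`, `c = w`, `p = ϖ`) -/
/-- S1a — the de Rham reduction: the derivative parts of terms 0 and 1 recover `F = g/Q`. [folklore] -/
theorem s1a (a b p : ℝ) (hp : p ≠ 0) (hQ : 1 - p * a - p * b ^ 2 - p ^ 2 * a * b ≠ 0)
    (hb : 1 + p * b ≠ 0) :
    ((-((p * b ^ 2 + 2 * b + p) * ((1 - p * a - p * b ^ 2 - p ^ 2 * a * b) + a * (-p - p ^ 2 * b))
          + b * (b + p) * (1 - p * b ^ 2) * p)) * (p * (1 + p * b) * (1 - p * a - p * b ^ 2 - p ^ 2 * a * b))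
        - (-((p * b ^ 2 + 2 * b + p) * a * (1 - p * a - p * b ^ 2 - p ^ 2 * a * b)
            + b * (b + p) * (1 - p * b ^ 2) * (2 * b + p * a))) * (-(p ^ 2 * (1 + p * b) ^ 2)))
        / (p * (1 + p * b) * (1 - p * a - p * b ^ 2 - p ^ 2 * a * b)) ^ 2
      + (((2 * b + p) * (1 - p * b ^ 2) - 2 * p * b ^ 2 * (b + p)) * (p * (1 - p * a - p * b ^ 2 - p ^ 2 * a * b))
          - (b * (b + p) * (1 - p * b ^ 2)) * (-(p ^ 2 * (2 * b + p * a))))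
        / (p * (1 - p * a - p * b ^ 2 - p ^ 2 * a * b)) ^ 2
      = (-2 * b ^ 3 + p * a * b ^ 2 - 2 * p * b ^ 2 + 2 * a * b + p * a) /
          (1 - p * a - p * b ^ 2 - p ^ 2 * a * b) := by
  have hD0 : (p * (1 + p * b) * (1 - p * a - p * b ^ 2 - p ^ 2 * a * b)) ^ 2 ≠ 0 := by positivity
  have hD1 : (p * (1 - p * a - p * b ^ 2 - p ^ 2 * a * b)) ^ 2 ≠ 0 := by positivity
  rw [div_add_div _ _ hD0 hD1, div_eq_div_iff (mul_ne_zero hD0 hD1) hQ]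
  ring

/-- S1b — the `z₁`-faces of term 0 are `−u₁(z₂) = γ·dlog Q(1,z₂)`. [folklore] -/
theorem s1b (b p : ℝ) (hp : p ≠ 0) (hq : 1 - p - p ^ 2 * b - p * b ^ 2 ≠ 0) (hb : 1 + p * b ≠ 0)
    (hb2 : 1 - p * b ^ 2 ≠ 0) :
    -((-((p * b ^ 2 + 2 * b + p) * (1 - p - p ^ 2 * b - p * b ^ 2)
          + b * (b + p) * (1 - p * b ^ 2) * (2 * b + p))) /
        (p * (1 + p * b) * (1 - p - p ^ 2 * b - p * b ^ 2)))
      + (-(b * (b + p) * (1 - p * b ^ 2) * (2 * b))) / (p * (1 + p * b) * (1 - p * b ^ 2))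
      = (1 - p) * (p + 2 * b) / (p * (1 - p - p ^ 2 * b - p * b ^ 2)) := by
  have h1 : p * (1 + p * b) * (1 - p - p ^ 2 * b - p * b ^ 2) ≠ 0 := by positivity
  have h2 : p * (1 + p * b) * (1 - p * b ^ 2) ≠ 0 := by positivity
  have h3 : p * (1 - p - p ^ 2 * b - p * b ^ 2) ≠ 0 := by positivity
  field_simp
  ring

/-- S1c — the `z₂`-faces of term 1 are `−u₂(z₁) = −γ·dlog Q(z₁,1)`. [folklore] -/
theorem s1c (a p : ℝ) :
    -(((1 + p) * (1 - p)) / (p * ((1 - p) - p * (1 + p) * a))) + 0 / (p * (1 - p * a))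
      = -((1 - p ^ 2) / (p * ((1 - p) - p * (1 + p) * a))) := by
  rw [zero_div, add_zero]
  congr 1
  ring

/-- S2 — terms 2 and 3 (Tate-homotopy kernel `1/((1−p) − p(1+p)z₁z₂)`) produce the swap
`u₂(z₁) − u₂(z₂)`, `u₂ = (1−p²)/(p·Q(·,1))`, with NO rule-(2) move. [folklore] -/
theorem s2 (a b p : ℝ) (hp : p ≠ 0) (hD : (1 - p) - p * (1 + p) * a * b ≠ 0)
    (hLa : (1 - p) - p * (1 + p) * a ≠ 0) (hLb : (1 - p) - p * (1 + p) * b ≠ 0) (h1 : 1 - p ≠ 0) :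
    (((1 - p ^ 2) * (p * ((1 - p) - p * (1 + p) * a * b)) - ((1 - p ^ 2) * a) * (-(p ^ 2 * (1 + p) * b)))
        / (p * ((1 - p) - p * (1 + p) * a * b)) ^ 2
      - ((1 - p ^ 2)) / (p * ((1 - p) - p * (1 + p) * b))
      + 0 / (p * (1 - p)))
    + (((-(1 - p ^ 2)) * (p * ((1 - p) - p * (1 + p) * a * b)) - (-((1 - p ^ 2) * b)) * (-(p ^ 2 * (1 + p) * a)))
        / (p * ((1 - p) - p * (1 + p) * a * b)) ^ 2
      - (-((1 - p ^ 2))) / (p * ((1 - p) - p * (1 + p) * a))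
      + (-0) / (p * (1 - p)))
    = (1 - p ^ 2) / (p * ((1 - p) - p * (1 + p) * a)) - (1 - p ^ 2) / (p * ((1 - p) - p * (1 + p) * b)) := by
  have hsq : (p * ((1 - p) - p * (1 + p) * a * b)) ^ 2 ≠ 0 := by positivity
  have hpa : p * ((1 - p) - p * (1 + p) * a) ≠ 0 := by positivity
  have hpb : p * ((1 - p) - p * (1 + p) * b) ≠ 0 := by positivity
  field_simp
  ring

/-- S3a — the derivative parts of the loop terms 4 and 5 cancel (`∂_x(Ψ_w/Ψ) = ∂_w(Ψ_x/Ψ)`). [folklore] -/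
theorem s3a (b c p : ℝ) (hp : p ≠ 0) (hq : 1 - p - p ^ 2 * b - p * b ^ 2 ≠ 0)
    (hM : (1 - c) * (1 - p - p ^ 2 * b - p * b ^ 2) + c * ((1 - p) - p * (1 + p) * b) ≠ 0) :
    (((1 - p) * (1 - 2 * b)) * (p * ((1 - c) * (1 - p - p ^ 2 * b - p * b ^ 2) + c * ((1 - p) - p * (1 + p) * b)))
        - ((1 - p) * b * (1 - b)) * (p * ((1 - c) * (-p ^ 2 - 2 * p * b) + c * (-(p * (1 + p))))))
      / (p * ((1 - c) * (1 - p - p ^ 2 * b - p * b ^ 2) + c * ((1 - p) - p * (1 + p) * b))) ^ 2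
    + ((-((1 - p) * ((1 - p) - 2 * (1 - p) * b + p * (1 + p) * b ^ 2)))
          * (p * (1 - p - p ^ 2 * b - p * b ^ 2) * ((1 - c) * (1 - p - p ^ 2 * b - p * b ^ 2) + c * ((1 - p) - p * (1 + p) * b)))
        - (-((1 - p) * c * ((1 - p) - 2 * (1 - p) * b + p * (1 + p) * b ^ 2)))
          * (p * (1 - p - p ^ 2 * b - p * b ^ 2) * (((1 - p) - p * (1 + p) * b) - (1 - p - p ^ 2 * b - p * b ^ 2))))
      / (p * (1 - p - p ^ 2 * b - p * b ^ 2) * ((1 - c) * (1 - p - p ^ 2 * b - p * b ^ 2) + c * ((1 - p) - p * (1 + p) * b))) ^ 2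
    = 0 := by
  have h4 : (p * ((1 - c) * (1 - p - p ^ 2 * b - p * b ^ 2) + c * ((1 - p) - p * (1 + p) * b))) ^ 2 ≠ 0 := by
    positivity
  have h5 : (p * (1 - p - p ^ 2 * b - p * b ^ 2) *
      ((1 - c) * (1 - p - p ^ 2 * b - p * b ^ 2) + c * ((1 - p) - p * (1 + p) * b))) ^ 2 ≠ 0 := by
    positivity
  rw [div_add_div _ _ h4 h5, div_eq_zero_iff]
  left
  ring

/-- S3b — of the faces of terms 4 and 5 only the `w = 1` face of term 5 survives, and it is the edge
family `E = u₁ + u₂ = γ·dlog(Q(·,1)/Q(1,·))` (`N = (1+p)q − (p+2b)L`). [folklore] -/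
theorem s3b (b p : ℝ) (hp : p ≠ 0) (hq : 1 - p - p ^ 2 * b - p * b ^ 2 ≠ 0)
    (hL : (1 - p) - p * (1 + p) * b ≠ 0) :
    -((-((1 - p) * ((1 - p) - 2 * (1 - p) * b + p * (1 + p) * b ^ 2))) /
        (p * (1 - p - p ^ 2 * b - p * b ^ 2) * ((1 - p) - p * (1 + p) * b)))
    = -((1 - p) * (p + 2 * b) / (p * (1 - p - p ^ 2 * b - p * b ^ 2)))
      + (1 - p ^ 2) / (p * ((1 - p) - p * (1 + p) * b)) := by
  have h1 : p * (1 - p - p ^ 2 * b - p * b ^ 2) * ((1 - p) - p * (1 + p) * b) ≠ 0 := by positivity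
  have h2 : p * (1 - p - p ^ 2 * b - p * b ^ 2) ≠ 0 := by positivity
  have h3 : p * ((1 - p) - p * (1 + p) * b) ≠ 0 := by positivity
  rw [neg_div', neg_div', neg_neg, div_add_div _ _ h2 h3, div_eq_div_iff h1 (mul_ne_zero h2 h3)]
  ring


/-! ### Evaluation of the certificate polynomials (variables `X 0 = z₁, X 1 = z₂, X 2 = w, X 3 = ϖ`) -/
/-- Value of the numerator `A_0`. [folklore] -/
theorem evalA0 (v : Fin (2 + 1 + 1) → ℝ) :
    aeval v ((-((X 3 * X 1 ^ 2 + C 2 * X 1 + X 3) * X 0 * (1 - X 3 * X 0 - X 3 * X 1 ^ 2 - X 3 ^ 2 * X 0 * X 1) + X 1 * (X 1 + X 3) * (1 - X 3 * X 1 ^ 2) * (C 2 * X 1 + X 3 * X 0))) : MvPolynomial (Fin (2 + 1 + 1)) ℚ) = (-((v 3 * v 1 ^ 2 + 2 * v 1 + v 3) * v 0 * (1 - v 3 * v 0 - v 3 * v 1 ^ 2 - v 3 ^ 2 * v 0 * v 1) + v 1 * (v 1 + v 3) * (1 - v 3 * v 1 ^ 2) * (2 * v 1 + v 3 * v 0)))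 := by
  simp
/-- Value of the denominator `D_0`. [folklore] -/
theorem evalD0 (v : Fin (2 + 1 + 1) → ℝ) :
    aeval v ((X 3 * (1 + X 3 * X 1) * (1 - X 3 * X 0 - X 3 * X 1 ^ 2 - X 3 ^ 2 * X 0 * X 1)) : MvPolynomial (Fin (2 + 1 + 1)) ℚ) = (v 3 * (1 + v 3 * v 1) * (1 - v 3 * v 0 - v 3 * v 1 ^ 2 - v 3 ^ 2 * v 0 * v 1)) := by
  simp
/-- Value of the derivative numerator `∂A_0·D_0 − A_0·∂D_0` along coordinate `0`. [folklore] -/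
theorem evalN0 (v : Fin (2 + 1 + 1) → ℝ) :
    aeval v (pderiv 0 ((-((X 3 * X 1 ^ 2 + C 2 * X 1 + X 3) * X 0 * (1 - X 3 * X 0 - X 3 * X 1 ^ 2 - X 3 ^ 2 * X 0 * X 1) + X 1 * (X 1 + X 3) * (1 - X 3 * X 1 ^ 2) * (C 2 * X 1 + X 3 * X 0))) : MvPolynomial (Fin (2 + 1 + 1)) ℚ) * (X 3 * (1 + X 3 * X 1) * (1 - X 3 * X 0 - X 3 * X 1 ^ 2 - X 3 ^ 2 * X 0 * X 1)) - (-((X 3 * X 1 ^ 2 + C 2 * X 1 + X 3) * X 0 * (1 - X 3 * X 0 - X 3 * X 1 ^ 2 - X 3 ^ 2 * X 0 * X 1) + X 1 * (X 1 + X 3) * (1 - X 3 * X 1 ^ 2) * (C 2 * X 1 + X 3 * X 0))) * pderiv 0 (X 3 * (1 + X 3 * X 1) * (1 - X 3 * X 0 - X 3 * X 1 ^ 2 - X 3 ^ 2 * X 0 * X 1))) =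
      (-((v 3 * v 1 ^ 2 + 2 * v 1 + v 3) * ((1 - v 3 * v 0 - v 3 * v 1 ^ 2 - v 3 ^ 2 * v 0 * v 1) + v 0 * (-v 3 - v 3 ^ 2 * v 1)) + v 1 * (v 1 + v 3) * (1 - v 3 * v 1 ^ 2) * v 3)) * (v 3 * (1 + v 3 * v 1) * (1 - v 3 * v 0 - v 3 * v 1 ^ 2 - v 3 ^ 2 * v 0 * v 1)) - (-((v 3 * v 1 ^ 2 + 2 * v 1 + v 3) * v 0 * (1 - v 3 * v 0 - v 3 * v 1 ^ 2 - v 3 ^ 2 * v 0 * v 1) + v 1 * (v 1 + v 3) * (1 - v 3 * v 1 ^ 2) * (2 * v 1 + v 3 * v 0))) * (-(v 3 ^ 2 * (1 + v 3 * v 1) ^ 2)) := by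
  simp [Derivation.leibniz, Derivation.leibniz_pow, smul_eq_mul, -mul_eq_mul_left_iff, -mul_eq_mul_right_iff]
  try ring
/-- Value of the numerator `A_1`. [folklore] -/
theorem evalA1 (v : Fin (2 + 1 + 1) → ℝ) :
    aeval v ((X 1 * (X 1 + X 3) * (1 - X 3 * X 1 ^ 2)) : MvPolynomial (Fin (2 + 1 + 1)) ℚ) = (v 1 * (v 1 + v 3) * (1 - v 3 * v 1 ^ 2)) := by
  simp
/-- Value of the denominator `D_1`. [folklore] -/
theorem evalD1 (v : Fin (2 + 1 + 1) → ℝ) :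
    aeval v ((X 3 * (1 - X 3 * X 0 - X 3 * X 1 ^ 2 - X 3 ^ 2 * X 0 * X 1)) : MvPolynomial (Fin (2 + 1 + 1)) ℚ) = (v 3 * (1 - v 3 * v 0 - v 3 * v 1 ^ 2 - v 3 ^ 2 * v 0 * v 1)) := by
  simp
/-- Value of the derivative numerator `∂A_1·D_1 − A_1·∂D_1` along coordinate `1`. [folklore] -/
theorem evalN1 (v : Fin (2 + 1 + 1) → ℝ) :
    aeval v (pderiv 1 ((X 1 * (X 1 + X 3) * (1 - X 3 * X 1 ^ 2)) : MvPolynomial (Fin (2 + 1 + 1)) ℚ) * (X 3 * (1 - X 3 * X 0 - X 3 * X 1 ^ 2 - X 3 ^ 2 * X 0 * X 1)) - (X 1 * (X 1 + X 3) * (1 - X 3 * X 1 ^ 2)) * pderiv 1 (X 3 * (1 - X 3 * X 0 - X 3 * X 1 ^ 2 - X 3 ^ 2 * X 0 * X 1))) =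
      ((2 * v 1 + v 3) * (1 - v 3 * v 1 ^ 2) - 2 * v 3 * v 1 ^ 2 * (v 1 + v 3)) * (v 3 * (1 - v 3 * v 0 - v 3 * v 1 ^ 2 - v 3 ^ 2 * v 0 * v 1)) - (v 1 * (v 1 + v 3) * (1 - v 3 * v 1 ^ 2)) * (-(v 3 ^ 2 * (2 * v 1 + v 3 * v 0))) := by
  simp [Derivation.leibniz, Derivation.leibniz_pow, smul_eq_mul, -mul_eq_mul_left_iff, -mul_eq_mul_right_iff]
  try ring
/-- Value of the numerator `A_2`. [folklore] -/
theorem evalA2 (v : Fin (2 + 1 + 1) → ℝ) :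
    aeval v (((1 - X 3 ^ 2) * X 0) : MvPolynomial (Fin (2 + 1 + 1)) ℚ) = ((1 - v 3 ^ 2) * v 0) := by
  simp
/-- Value of the denominator `D_2`. [folklore] -/
theorem evalD2 (v : Fin (2 + 1 + 1) → ℝ) :
    aeval v ((X 3 * ((1 - X 3) - X 3 * (1 + X 3) * X 0 * X 1)) : MvPolynomial (Fin (2 + 1 + 1)) ℚ) = (v 3 * ((1 - v 3) - v 3 * (1 + v 3) * v 0 * v 1)) := by
  simp
/-- Value of the derivative numerator `∂A_2·D_2 − A_2·∂D_2` along coordinate `0`. [folklore] -/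
theorem evalN2 (v : Fin (2 + 1 + 1) → ℝ) :
    aeval v (pderiv 0 (((1 - X 3 ^ 2) * X 0) : MvPolynomial (Fin (2 + 1 + 1)) ℚ) * (X 3 * ((1 - X 3) - X 3 * (1 + X 3) * X 0 * X 1)) - ((1 - X 3 ^ 2) * X 0) * pderiv 0 (X 3 * ((1 - X 3) - X 3 * (1 + X 3) * X 0 * X 1))) =
      (1 - v 3 ^ 2) * (v 3 * ((1 - v 3) - v 3 * (1 + v 3) * v 0 * v 1)) - ((1 - v 3 ^ 2) * v 0) * (-(v 3 ^ 2 * (1 + v 3) * v 1)) := by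
  simp [Derivation.leibniz, Derivation.leibniz_pow, smul_eq_mul, -mul_eq_mul_left_iff, -mul_eq_mul_right_iff]
  try ring
/-- Value of the numerator `A_3`. [folklore] -/
theorem evalA3 (v : Fin (2 + 1 + 1) → ℝ) :
    aeval v ((-((1 - X 3 ^ 2) * X 1)) : MvPolynomial (Fin (2 + 1 + 1)) ℚ) = (-((1 - v 3 ^ 2) * v 1)) := by
  simp
/-- Value of the derivative numerator `∂A_3·D_3 − A_3·∂D_3` along coordinate `1`. [folklore] -/
theorem evalN3 (v : Fin (2 + 1 + 1) → ℝ) :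
    aeval v (pderiv 1 ((-((1 - X 3 ^ 2) * X 1)) : MvPolynomial (Fin (2 + 1 + 1)) ℚ) * (X 3 * ((1 - X 3) - X 3 * (1 + X 3) * X 0 * X 1)) - (-((1 - X 3 ^ 2) * X 1)) * pderiv 1 (X 3 * ((1 - X 3) - X 3 * (1 + X 3) * X 0 * X 1))) =
      (-(1 - v 3 ^ 2)) * (v 3 * ((1 - v 3) - v 3 * (1 + v 3) * v 0 * v 1)) - (-((1 - v 3 ^ 2) * v 1)) * (-(v 3 ^ 2 * (1 + v 3) * v 0)) := by
  simp [Derivation.leibniz, Derivation.leibniz_pow, smul_eq_mul, -mul_eq_mul_left_iff, -mul_eq_mul_right_iff]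
  try ring
/-- Value of the numerator `A_4`. [folklore] -/
theorem evalA4 (v : Fin (2 + 1 + 1) → ℝ) :
    aeval v (((1 - X 3) * X 1 * (1 - X 1)) : MvPolynomial (Fin (2 + 1 + 1)) ℚ) = ((1 - v 3) * v 1 * (1 - v 1)) := by
  simp
/-- Value of the denominator `D_4`. [folklore] -/
theorem evalD4 (v : Fin (2 + 1 + 1) → ℝ) :
    aeval v ((X 3 * ((1 - X 2) * (1 - X 3 - X 3 ^ 2 * X 1 - X 3 * X 1 ^ 2) + X 2 * ((1 - X 3) - X 3 * (1 + X 3) * X 1))) : MvPolynomial (Fin (2 + 1 + 1)) ℚ) = (v 3 * ((1 - v 2) * (1 - v 3 - v 3 ^ 2 * v 1 - v 3 * v 1 ^ 2) + v 2 * ((1 - v 3) - v 3 * (1 + v 3) * v 1))) := by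
  simp
/-- Value of the derivative numerator `∂A_4·D_4 − A_4·∂D_4` along coordinate `1`. [folklore] -/
theorem evalN4 (v : Fin (2 + 1 + 1) → ℝ) :
    aeval v (pderiv 1 (((1 - X 3) * X 1 * (1 - X 1)) : MvPolynomial (Fin (2 + 1 + 1)) ℚ) * (X 3 * ((1 - X 2) * (1 - X 3 - X 3 ^ 2 * X 1 - X 3 * X 1 ^ 2) + X 2 * ((1 - X 3) - X 3 * (1 + X 3) * X 1))) - ((1 - X 3) * X 1 * (1 - X 1)) * pderiv 1 (X 3 * ((1 - X 2) * (1 - X 3 - X 3 ^ 2 * X 1 - X 3 * X 1 ^ 2) + X 2 * ((1 - X 3) - X 3 * (1 + X 3) * X 1)))) =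
      ((1 - v 3) * (1 - 2 * v 1)) * (v 3 * ((1 - v 2) * (1 - v 3 - v 3 ^ 2 * v 1 - v 3 * v 1 ^ 2) + v 2 * ((1 - v 3) - v 3 * (1 + v 3) * v 1))) - ((1 - v 3) * v 1 * (1 - v 1)) * (v 3 * ((1 - v 2) * (-v 3 ^ 2 - 2 * v 3 * v 1) + v 2 * (-(v 3 * (1 + v 3))))) := by
  simp [Derivation.leibniz, Derivation.leibniz_pow, smul_eq_mul, -mul_eq_mul_left_iff, -mul_eq_mul_right_iff]
  try ring
/-- Value of the numerator `A_5`. [folklore] -/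
theorem evalA5 (v : Fin (2 + 1 + 1) → ℝ) :
    aeval v ((-((1 - X 3) * X 2 * ((1 - X 3) - C 2 * (1 - X 3) * X 1 + X 3 * (1 + X 3) * X 1 ^ 2))) : MvPolynomial (Fin (2 + 1 + 1)) ℚ) = (-((1 - v 3) * v 2 * ((1 - v 3) - 2 * (1 - v 3) * v 1 + v 3 * (1 + v 3) * v 1 ^ 2))) := by
  simp
/-- Value of the denominator `D_5`. [folklore] -/
theorem evalD5 (v : Fin (2 + 1 + 1) → ℝ) :
    aeval v ((X 3 * (1 - X 3 - X 3 ^ 2 * X 1 - X 3 * X 1 ^ 2) * ((1 - X 2) * (1 - X 3 - X 3 ^ 2 * X 1 - X 3 * X 1 ^ 2) + X 2 * ((1 - X 3) - X 3 * (1 + X 3) * X 1))) : MvPolynomial (Fin (2 + 1 + 1)) ℚ) = (v 3 * (1 - v 3 - v 3 ^ 2 * v 1 - v 3 * v 1 ^ 2) * ((1 - v 2) * (1 - v 3 - v 3 ^ 2 * v 1 - v 3 * v 1 ^ 2) + v 2 * ((1 - v 3) - v 3 * (1 + v 3) * v 1))) := by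
  simp
/-- Value of the derivative numerator `∂A_5·D_5 − A_5·∂D_5` along coordinate `2`. [folklore] -/
theorem evalN5 (v : Fin (2 + 1 + 1) → ℝ) :
    aeval v (pderiv 2 ((-((1 - X 3) * X 2 * ((1 - X 3) - C 2 * (1 - X 3) * X 1 + X 3 * (1 + X 3) * X 1 ^ 2))) : MvPolynomial (Fin (2 + 1 + 1)) ℚ) * (X 3 * (1 - X 3 - X 3 ^ 2 * X 1 - X 3 * X 1 ^ 2) * ((1 - X 2) * (1 - X 3 - X 3 ^ 2 * X 1 - X 3 * X 1 ^ 2) + X 2 * ((1 - X 3) - X 3 * (1 + X 3) * X 1))) - (-((1 - X 3) * X 2 * ((1 - X 3) - C 2 * (1 - X 3) * X 1 + X 3 * (1 + X 3) * X 1 ^ 2))) * pderiv 2 (X 3 * (1 - X 3 - X 3 ^ 2 * X 1 - X 3 * X 1 ^ 2) * ((1 - X 2) * (1 - X 3 - X 3 ^ 2 * X 1 - X 3 * X 1 ^ 2) + X 2 * ((1 - X 3) - X 3 * (1 + X 3) * X 1)))) =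
      (-((1 - v 3) * ((1 - v 3) - 2 * (1 - v 3) * v 1 + v 3 * (1 + v 3) * v 1 ^ 2))) * (v 3 * (1 - v 3 - v 3 ^ 2 * v 1 - v 3 * v 1 ^ 2) * ((1 - v 2) * (1 - v 3 - v 3 ^ 2 * v 1 - v 3 * v 1 ^ 2) + v 2 * ((1 - v 3) - v 3 * (1 + v 3) * v 1))) - (-((1 - v 3) * v 2 * ((1 - v 3) - 2 * (1 - v 3) * v 1 + v 3 * (1 + v 3) * v 1 ^ 2))) * (v 3 * (1 - v 3 - v 3 ^ 2 * v 1 - v 3 * v 1 ^ 2) * (((1 - v 3) - v 3 * (1 + v 3) * v 1) - (1 - v 3 - v 3 ^ 2 * v 1 - v 3 * v 1 ^ 2))) := by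
  simp [Derivation.leibniz, Derivation.leibniz_pow, smul_eq_mul, -mul_eq_mul_left_iff, -mul_eq_mul_right_iff]
  try ring

/-! ### Reading `Fin.snoc w ϖ₀` and `Fin.snoc z ϖ₀` at literal coordinates -/

/-- [folklore] -/
theorem snoc4_0 (w : Fin (2 + 1) → ℝ) (t : ℝ) : (Fin.snoc w t : Fin (2 + 1 + 1) → ℝ) 0 = w 0 := rfl
/-- [folklore] -/
theorem snoc4_1 (w : Fin (2 + 1) → ℝ) (t : ℝ) : (Fin.snoc w t : Fin (2 + 1 + 1) → ℝ) 1 = w 1 := rfl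
/-- [folklore] -/
theorem snoc4_2 (w : Fin (2 + 1) → ℝ) (t : ℝ) : (Fin.snoc w t : Fin (2 + 1 + 1) → ℝ) 2 = w 2 := rfl
/-- [folklore] -/
theorem snoc4_3 (w : Fin (2 + 1) → ℝ) (t : ℝ) : (Fin.snoc w t : Fin (2 + 1 + 1) → ℝ) 3 = t := rfl
/-- [folklore] -/
theorem snoc3_0 (z : Fin 2 → ℝ) (t : ℝ) : (Fin.snoc z t : Fin (2 + 1) → ℝ) 0 = z 0 := rfl
/-- [folklore] -/
theorem snoc3_1 (z : Fin 2 → ℝ) (t : ℝ) : (Fin.snoc z t : Fin (2 + 1) → ℝ) 1 = z 1 := rfl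
/-- [folklore] -/
theorem snoc3_2 (z : Fin 2 → ℝ) (t : ℝ) : (Fin.snoc z t : Fin (2 + 1) → ℝ) 2 = t := rfl

/-- Value of the family numerator `g`. [folklore] -/
theorem evalP (v : Fin (2 + 1) → ℝ) :
    aeval v ((-(C 2 * X 1 ^ 3) + X 2 * X 0 * X 1 ^ 2 - C 2 * X 2 * X 1 ^ 2 + C 2 * X 0 * X 1 + X 2 * X 0) : MvPolynomial (Fin (2 + 1)) ℚ) =
      -(2 * v 1 ^ 3) + v 2 * v 0 * v 1 ^ 2 - 2 * v 2 * v 1 ^ 2 + 2 * v 0 * v 1 + v 2 * v 0 := by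
  simp

/-- Value of the family denominator `Q`. [folklore] -/
theorem evalQ (v : Fin (2 + 1) → ℝ) :
    aeval v ((1 - X 2 * X 0 - X 2 * X 1 ^ 2 - X 2 ^ 2 * X 0 * X 1) : MvPolynomial (Fin (2 + 1)) ℚ) =
      1 - v 2 * v 0 - v 2 * v 1 ^ 2 - v 2 ^ 2 * v 0 * v 1 := by
  simp

/-! ### Positivity of the denominators on the closed cube for admissible `ϖ₀` -/

/-- `Q(z₁,z₂) ≥ 1 − 2p − p² > 0` on the closed square. [folklore] -/
theorem Q_pos {p a b : ℝ} (h0 : 0 < p) (h1 : p ^ 2 + 2 * p < 1) (ha : 0 ≤ a ∧ a ≤ 1) (hb : 0 ≤ b ∧ b ≤ 1) :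
    0 < 1 - p * a - p * b ^ 2 - p ^ 2 * a * b := by
  nlinarith [mul_nonneg ha.1 hb.1, mul_le_one₀ ha.2 hb.1 hb.2, mul_le_one₀ hb.2 hb.1 hb.2,
    sq_nonneg b, mul_pos h0 h0]

/-- `q(b) = Q(1,b) > 0`. [folklore] -/
theorem q_pos {p b : ℝ} (h0 : 0 < p) (h1 : p ^ 2 + 2 * p < 1) (hb : 0 ≤ b ∧ b ≤ 1) :
    0 < 1 - p - p ^ 2 * b - p * b ^ 2 := by
  nlinarith [mul_le_one₀ hb.2 hb.1 hb.2, sq_nonneg b, mul_pos h0 h0]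

/-- `L(b) = Q(b,1) > 0`. [folklore] -/
theorem L_pos {p b : ℝ} (h0 : 0 < p) (h1 : p ^ 2 + 2 * p < 1) (hb : 0 ≤ b ∧ b ≤ 1) :
    0 < (1 - p) - p * (1 + p) * b := by
  nlinarith [mul_pos h0 h0]

/-- The Tate-homotopy kernel `Q(ab,1) > 0`. [folklore] -/
theorem Dab_pos {p a b : ℝ} (h0 : 0 < p) (h1 : p ^ 2 + 2 * p < 1) (ha : 0 ≤ a ∧ a ≤ 1) (hb : 0 ≤ b ∧ b ≤ 1) :
    0 < (1 - p) - p * (1 + p) * a * b := by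
  nlinarith [mul_nonneg ha.1 hb.1, mul_le_one₀ ha.2 hb.1 hb.2, mul_pos h0 h0]

/-- The loop homotopy `M = (1−c)q + cL > 0`. [folklore] -/
theorem M_pos {p b c : ℝ} (h0 : 0 < p) (h1 : p ^ 2 + 2 * p < 1) (hb : 0 ≤ b ∧ b ≤ 1) (hc : 0 ≤ c ∧ c ≤ 1) :
    0 < (1 - c) * (1 - p - p ^ 2 * b - p * b ^ 2) + c * ((1 - p) - p * (1 + p) * b) := by
  have hq := q_pos h0 h1 hb
  have hL := L_pos h0 h1 hb
  rcases eq_or_lt_of_le hc.1 with h | h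
  · rw [← h]; linarith
  · nlinarith [mul_nonneg (sub_nonneg.2 hc.2) hq.le, mul_pos h hL]

end Gap

open Gap in
set_option maxRecDepth 8192 in
/-- STUB `stub_gapInstance` of line `Sketch` — **the gap element's tame fibres are relations.**
For real-algebraic `ϖ₀` with `0 < ϖ₀`,
`ϖ₀² + 2ϖ₀ < 1` (the whole admissible range of `Q = 1 − ϖz₁ − ϖz₂² − ϖ²z₁z₂`), every tame cube
representation of the fibre `g/Q(·, ϖ₀)` on `[0,1]²` lies in `KZ.relations`: the six-term rational
`relA` certificate above fed to `rational_certificate`. [cite: KontsevichZagier2001, §1.1–1.2]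
[cite: Ayoub2014, Def. 10] -/
theorem stub_gapInstance :
    ∀ (ϖ₀ : ℝ), IsAlgebraic ℚ ϖ₀ → 0 < ϖ₀ → ϖ₀ ^ 2 + 2 * ϖ₀ < 1 →
      ∀ Φ : KZ.IntegralRep 2, Φ.IsTameCube →
        (∀ z ∈ KZ.cube 2, Φ.integrand z =
          aeval (Fin.snoc z ϖ₀ : Fin (2 + 1) → ℝ) ((-(C 2 * X 1 ^ 3) + X 2 * X 0 * X 1 ^ 2 - C 2 * X 2 * X 1 ^ 2 + C 2 * X 0 * X 1 + X 2 * X 0) : MvPolynomial (Fin (2 + 1)) ℚ) /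
            aeval (Fin.snoc z ϖ₀ : Fin (2 + 1) → ℝ) ((1 - X 2 * X 0 - X 2 * X 1 ^ 2 - X 2 ^ 2 * X 0 * X 1) : MvPolynomial (Fin (2 + 1)) ℚ)) →
        KZ.of Φ ∈ KZ.relations := by
  intro ϖ₀ halg h0 h1 Φ hΦ hΦi
  have hp : ϖ₀ ≠ 0 := h0.ne'
  have hp1 : 1 - ϖ₀ ≠ 0 := by nlinarith
  refine rational_certificate (n := 2) (m := 1) (K := 6) _ _
    ![(-((X 3 * X 1 ^ 2 + C 2 * X 1 + X 3) * X 0 * (1 - X 3 * X 0 - X 3 * X 1 ^ 2 - X 3 ^ 2 * X 0 * X 1) + X 1 * (X 1 + X 3) * (1 - X 3 * X 1 ^ 2) * (C 2 * X 1 + X 3 * X 0))),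
      (X 1 * (X 1 + X 3) * (1 - X 3 * X 1 ^ 2)),
      ((1 - X 3 ^ 2) * X 0),
      (-((1 - X 3 ^ 2) * X 1)),
      ((1 - X 3) * X 1 * (1 - X 1)),
      (-((1 - X 3) * X 2 * ((1 - X 3) - C 2 * (1 - X 3) * X 1 + X 3 * (1 + X 3) * X 1 ^ 2)))]
    ![(X 3 * (1 + X 3 * X 1) * (1 - X 3 * X 0 - X 3 * X 1 ^ 2 - X 3 ^ 2 * X 0 * X 1)),
      (X 3 * (1 - X 3 * X 0 - X 3 * X 1 ^ 2 - X 3 ^ 2 * X 0 * X 1)),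
      (X 3 * ((1 - X 3) - X 3 * (1 + X 3) * X 0 * X 1)),
      (X 3 * ((1 - X 3) - X 3 * (1 + X 3) * X 0 * X 1)),
      (X 3 * ((1 - X 2) * (1 - X 3 - X 3 ^ 2 * X 1 - X 3 * X 1 ^ 2) + X 2 * ((1 - X 3) - X 3 * (1 + X 3) * X 1))),
      (X 3 * (1 - X 3 - X 3 ^ 2 * X 1 - X 3 * X 1 ^ 2) * ((1 - X 2) * (1 - X 3 - X 3 ^ 2 * X 1 - X 3 * X 1 ^ 2) + X 2 * ((1 - X 3) - X 3 * (1 + X 3) * X 1)))]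
    ![0, 1, 0, 1, 1, 2] halg (fun z hz => ?_) (fun k w hw => ?_) (fun w hw => ?_) Φ hΦ hΦi
  · -- `Q(z, ϖ₀) ≠ 0` on the closed square
    rw [evalQ, snoc3_0, snoc3_1, snoc3_2]
    exact (Q_pos h0 h1 (KZ.mem_cube.1 hz 0) (KZ.mem_cube.1 hz 1)).ne'
  · -- the six denominators do not vanish on the closed cube
    have ha := KZ.mem_cube.1 hw 0
    have hb := KZ.mem_cube.1 hw 1
    have hc := KZ.mem_cube.1 hw 2
    have hQ := Q_pos h0 h1 ha hb
    have hq := q_pos h0 h1 hb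
    have hM := M_pos h0 h1 hb hc
    have hD := Dab_pos h0 h1 ha hb
    have hb1 : 0 < 1 + ϖ₀ * w 1 := by nlinarith [hb.1]
    fin_cases k
    · show aeval (Fin.snoc w ϖ₀ : Fin (2 + 1 + 1) → ℝ) ((X 3 * (1 + X 3 * X 1) * (1 - X 3 * X 0 - X 3 * X 1 ^ 2 - X 3 ^ 2 * X 0 * X 1)) : MvPolynomial (Fin (2 + 1 + 1)) ℚ) ≠ 0
      rw [evalD0, snoc4_0, snoc4_1, snoc4_3]; positivity
    · show aeval (Fin.snoc w ϖ₀ : Fin (2 + 1 + 1) → ℝ) ((X 3 * (1 - X 3 * X 0 - X 3 * X 1 ^ 2 - X 3 ^ 2 * X 0 * X 1)) : MvPolynomial (Fin (2 + 1 + 1)) ℚ) ≠ 0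
      rw [evalD1, snoc4_0, snoc4_1, snoc4_3]; positivity
    · show aeval (Fin.snoc w ϖ₀ : Fin (2 + 1 + 1) → ℝ) ((X 3 * ((1 - X 3) - X 3 * (1 + X 3) * X 0 * X 1)) : MvPolynomial (Fin (2 + 1 + 1)) ℚ) ≠ 0
      rw [evalD2, snoc4_0, snoc4_1, snoc4_3]; positivity
    · show aeval (Fin.snoc w ϖ₀ : Fin (2 + 1 + 1) → ℝ) ((X 3 * ((1 - X 3) - X 3 * (1 + X 3) * X 0 * X 1)) : MvPolynomial (Fin (2 + 1 + 1)) ℚ) ≠ 0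
      rw [evalD2, snoc4_0, snoc4_1, snoc4_3]; positivity
    · show aeval (Fin.snoc w ϖ₀ : Fin (2 + 1 + 1) → ℝ) ((X 3 * ((1 - X 2) * (1 - X 3 - X 3 ^ 2 * X 1 - X 3 * X 1 ^ 2) + X 2 * ((1 - X 3) - X 3 * (1 + X 3) * X 1))) : MvPolynomial (Fin (2 + 1 + 1)) ℚ) ≠ 0
      rw [evalD4, snoc4_1, snoc4_2, snoc4_3]; positivity
    · show aeval (Fin.snoc w ϖ₀ : Fin (2 + 1 + 1) → ℝ) ((X 3 * (1 - X 3 - X 3 ^ 2 * X 1 - X 3 * X 1 ^ 2) * ((1 - X 2) * (1 - X 3 - X 3 ^ 2 * X 1 - X 3 * X 1 ^ 2) + X 2 * ((1 - X 3) - X 3 * (1 + X 3) * X 1))) : MvPolynomial (Fin (2 + 1 + 1)) ℚ) ≠ 0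
      rw [evalD5, snoc4_1, snoc4_2, snoc4_3]; positivity
  · -- the pointwise identity on `[0,1]³`
    have ha := KZ.mem_cube.1 hw 0
    have hb := KZ.mem_cube.1 hw 1
    have hc := KZ.mem_cube.1 hw 2
    have hQ := (Q_pos h0 h1 ha hb).ne'
    have hq := (q_pos h0 h1 hb).ne'
    have hLa := (L_pos h0 h1 ha).ne'
    have hLb := (L_pos h0 h1 hb).ne'
    have hM := (M_pos h0 h1 hb hc).ne'
    have hD := (Dab_pos h0 h1 ha hb).ne'
    have hb1 : 1 + ϖ₀ * w 1 ≠ 0 := by nlinarith [hb.1]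
    have hb2 : 1 - ϖ₀ * w 1 ^ 2 ≠ 0 := by nlinarith [hb.1, hb.2, mul_le_one₀ hb.2 hb.1 hb.2]
    have ha1 : 1 - ϖ₀ * w 0 ≠ 0 := by nlinarith [ha.1, ha.2]
    have hc2 : (Fin.castSucc (2 : Fin (2 + 1)) : Fin (2 + 1 + 1)) = 2 := rfl
    have hca0 : (Fin.castAdd 1 (0 : Fin 2) : Fin (2 + 1)) = 0 := rfl
    have hca1 : (Fin.castAdd 1 (1 : Fin 2) : Fin (2 + 1)) = 1 := rfl
    have e1 := s1a (w 0) (w 1) ϖ₀ hp hQ hb1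
    have e2 := s1b (w 1) ϖ₀ hp hq hb1 hb2
    have e3 := s1c (w 0) ϖ₀
    have e4 := s2 (w 0) (w 1) ϖ₀ hp hD hLa hLb hp1
    have e5 := s3a (w 1) (w 2) ϖ₀ hp hq hM
    have e6 := s3b (w 1) ϖ₀ hp hq hLb
    simp only [Fin.sum_univ_succ, Fin.sum_univ_zero, Matrix.cons_val_zero, Matrix.cons_val_succ,
      Fin.castSucc_zero, Fin.castSucc_one, hc2]
    simp only [map_pow, evalN0, evalN1, evalN2, evalN3, evalN4, evalN5, evalA0, evalA1, evalA2, evalA3,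
      evalA4, evalA5, evalD0, evalD1, evalD2, evalD4, evalD5, evalP, evalQ]
    simp only [snoc4_0, snoc4_1, snoc4_2, snoc4_3, snoc3_0, snoc3_1, snoc3_2, hca0, hca1]
    have hu00 : Function.update w 0 (1 : ℝ) 0 = 1 := Function.update_self ..
    have hu01 : Function.update w 0 (1 : ℝ) 1 = w 1 := Function.update_of_ne (by decide) ..
    have hz00 : Function.update w 0 (0 : ℝ) 0 = 0 := Function.update_self ..
    have hz01 : Function.update w 0 (0 : ℝ) 1 = w 1 := Function.update_of_ne (by decide) ..
    have hu10 : Function.update w 1 (1 : ℝ) 0 = w 0 := Function.update_of_ne (by decide) ..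
    have hu11 : Function.update w 1 (1 : ℝ) 1 = 1 := Function.update_self ..
    have hu12 : Function.update w 1 (1 : ℝ) 2 = w 2 := Function.update_of_ne (by decide) ..
    have hz10 : Function.update w 1 (0 : ℝ) 0 = w 0 := Function.update_of_ne (by decide) ..
    have hz11 : Function.update w 1 (0 : ℝ) 1 = 0 := Function.update_self ..
    have hz12 : Function.update w 1 (0 : ℝ) 2 = w 2 := Function.update_of_ne (by decide) ..
    have hu21 : Function.update w 2 (1 : ℝ) 1 = w 1 := Function.update_of_ne (by decide) ..
    have hu22 : Function.update w 2 (1 : ℝ) 2 = 1 := Function.update_self ..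
    have hz21 : Function.update w 2 (0 : ℝ) 1 = w 1 := Function.update_of_ne (by decide) ..
    have hz22 : Function.update w 2 (0 : ℝ) 2 = 0 := Function.update_self ..
    simp only [hu00, hu01, hz00, hz01, hu10, hu11, hu12, hz10, hz11, hz12, hu21, hu22, hz21, hz22]
    linear_combination -e1 - e2 - e3 - e4 - e5 - e6

end Summit.KontsevichZagierPeriods.InverseLandau.TateFamilyKernel.Descent
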